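import Literature.Barriers.RiemannHypothesis.TuranPartialSumsShiftCheck
import HarnessLib

/-!
# Sections of `ζ` beyond `σ = 1`: the vertical-shift construction — the covering by cells

Barrier catalogue `Literature/Barriers/RiemannHypothesis/`, companion of
`TuranPartialSumsShiftCheck.lean`. The `85` cells `L = log N ∈ [Lᵢ, Lᵢ₊₁]` (in hundredths,
geometric with ratio `≈ 1 + 0.001 L`, from `L₀ = 12.75 < log 360000` on) and the last cell
`[3720.69, ∞)`, in three chunks (one compiled evaluation each, `TuranPartialSumsShiftRun1–3.lean`);
`TuranPartialSumsShiftHolds.lean` proves that they cover every `N ≥ 360000` and concludes.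

## References

* The tree's `TuranPartialSumsShiftCheck.lean`. [folklore]
-/

namespace Literature.Barriers.RiemannHypothesis

namespace TuranShift

namespace Cert

/-- Break points (values of `100 · L`), chunk 1. [folklore] -/
def breaks1 : List ℕ := [1275, 1291, 1307, 1324, 1341, 1358, 1376, 1394, 1413, 1432, 1452, 1473, 1494, 1516, 1538, 1561, 1585, 1610, 1635, 1661, 1688, 1716, 1745, 1775, 1806, 1838, 1871, 1906, 1942]

/-- Break points, chunk 2. [folklore] -/
def breaks2 : List ℕ := [1942, 1979, 2018, 2058, 2100, 2144, 2189, 2236, 2285, 2337, 2391, 2448, 2507, 2569, 2634, 2703, 2776, 2853, 2934, 3020, 3111, 3207, 3309, 3418, 3534, 3658, 3791, 3934, 4088]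

/-- Break points, chunk 3. [folklore] -/
def breaks3 : List ℕ := [4088, 4255, 4436, 4632, 4846, 5080, 5338, 5622, 5938, 6290, 6685, 7131, 7639, 8222, 8898, 9689, 10627, 11756, 13138, 14864, 17073, 19987, 23981, 29731, 38570, 53446, 82010, 149266, 372069]

/-- The cells between consecutive break points (denominator `100`). [folklore] -/
def cellsBetween : List ℕ → List Cell
  | a :: b :: rest => ⟨a, b, 100⟩ :: cellsBetween (b :: rest)
  | _ => []

/-- The last (unbounded) cell `[3720.69, ∞)`. [folklore] -/
def lastCell : Cell := ⟨372069, 0, 100⟩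

/-- Chunk 1 of the cover. [folklore] -/
def cover1 : List Cell := cellsBetween breaks1

/-- Chunk 2 of the cover. [folklore] -/
def cover2 : List Cell := cellsBetween breaks2

/-- Chunk 3 of the cover (with the unbounded cell). [folklore] -/
def cover3 : List Cell := cellsBetween breaks3 ++ [lastCell]

end Cert

end TuranShift

end Literature.Barriers.RiemannHypothesis
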